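import Summits.ValiantsHypothesis.ValiantsHypothesis.Theses.FeketeSOS
import Literature.Computability.AlgebraicComplexity.SetMultilinear
import Literature.Computability.AlgebraicComplexity.SOSDecompositionProofs
import Literature.Computability.AlgebraicComplexity.ValiantClasses
import Summits.ValiantsHypothesis.ValiantsHypothesis.Theorems.FeketeSOSSOSMagnificationStubBudget
import Summits.ValiantsHypothesis.ValiantsHypothesis.Theorems.FeketeSOSSOSMagnificationStubDigitKronecker
import Summits.ValiantsHypothesis.ValiantsHypothesis.Theorems.FeketeSOSSOSMagnificationStubLegendreCircuit
import Summits.ValiantsHypothesis.ValiantsHypothesis.Theorems.FeketeSOSSOSMagnificationStubOneHotLtCircuit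
import Summits.ValiantsHypothesis.ValiantsHypothesis.Theorems.FeketeSOSSOSMagnificationStubPolarisedSOS
import Summits.ValiantsHypothesis.ValiantsHypothesis.Theorems.FeketeSOSSOSMagnificationStubVnpAssembly

/-!
# FeketeSOS — `Assembly` (item stmt-ValiantsHypothesis-14917): `FeketeSOSHard → ValiantsHypothesis`

The rank-1 assembly item of route `FeketeSOS` in its rev-4 form: the route thesis
`FeketeSOSHard` (Fekete polynomials are SOS-hard against few sparse squares of degree `≤ p²`)
alone implies Valiant's hypothesis `VP_ℂ ≠ VNP_ℂ`.  This is the Dutta–Saxena–Thierauf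
magnification for the Fekete family — literally the bridge crux `SOSMagnification`
(item stmt-ValiantsHypothesis-3995), whose hypothesis is `FeketeSOSHard` inlined verbatim.

The proof is the composition of the seven landed stubs of crux line `sml-polarised-transport`
(`Theorems/FeketeSOSSOSMagnificationStub*.lean`, namespace
`Summit.ValiantsHypothesis.ValiantsHypothesis.Theorems.FeketeSOSSOSMagnification`), following the
kernel-checked composition `SOSMagnification_of` of the registered skeleton
`Cruxes/SOSMagnification/Lines/sml-polarised-transport.lean`, with the skeleton's local
definitions (`fekDigit`, `kron`, `feketePoly`) inlined so that this file is definition-free.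

## The argument (growing radix `k = n + 1`, one explicit family)

Fix an odd prime selector `p_n` with `(n+1)^n / 2 < p_n ≤ (n+1)^n` for `n ≥ 2` (Bertrand) and let
`P_n ∈ ℂ[y_{j,ℓ} : j < n, ℓ ≤ n]` be the one-hot base-`(n+1)` digit lift of the Fekete polynomial
`F_{p_n} = Σ_{m < p_n} (m | p_n) X^m`.  Assume `FeketeSOSHard` with data `(δ, p₀)` and, for
contradiction, `VP_ℂ = VNP_ℂ`.
1. `stub_vnpAssembly` (with `stub_legendreCircuit`, `stub_oneHotLtCircuit`; Valiant's criterion,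
   Euler's criterion on a Boolean mod-`p` bus): `(P_n) ∈ VNP_ℂ`, hence `(P_n) ∈ VP_ℂ`, i.e.
   `L(P_n) ≤ n^c + c` for some `c`.
2. `exists_bilin_of_two_le_totalDegree` (DST24 Lemma 3.1, steps 1–4; VSBR middle cut):
   `P_n = Σ_{ℓ<t} g_ℓ h_ℓ` with `deg g_ℓ ≤ n/2`, `deg h_ℓ ≤ n − n/2`, `t ≤ (n+1)(16 L² (n+1)⁴)^⌊log₂ n⌋`.
3. `stub_polarisedSOS` (set-multilinear projection + polarisation): `P_n = Σ_{i<s} a_i q_i²` with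
   `s ≤ 2^{n+1} t`, each `q_i` block-sub-multilinear with `≤ (n+1)^{n/2} + (n+1)^{n−n/2}` monomials.
4. `stub_digitKronecker`: the inverse Kronecker substitution `y_{j,ℓ} ↦ X^{ℓ (n+1)^j}` maps `P_n`
   to `F_{p_n}`, does not increase supports, and keeps `natDegree ≤ (n+1)^n − 1 ≤ p_n²`.
5. `stub_budget`: for `n` large, `s ≤ p_n^δ` and the support sum is `< p_n^{1/2+δ}`, contradicting
   `FeketeSOSHard` at the prime `p_n ≥ n ≥ p₀`.

References: Dutta–Saxena–Thierauf 2024 (Thm 3.2/3.9, Lemma 3.1, Remark 2), Bürgisser 2000 (Ch. 2),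
Valiant 1979.
-/

-- `Summit.ValiantsHypothesis.ValiantsHypothesis.…` is the tree's mandated single-conjunct layout
-- (Sub = Summit), so the duplicated namespace component is intended.
set_option linter.dupNamespace false

noncomputable section

open MvPolynomial Finset
open Literature.Computability.AlgebraicComplexity
open Summit.ValiantsHypothesis.ValiantsHypothesis.Theorems.FeketeSOSSOSMagnification
  (stub_legendreCircuit stub_oneHotLtCircuit stub_vnpAssembly stub_digitKronecker
    stub_polarisedSOS stub_budget)

namespace Summit.ValiantsHypothesis.ValiantsHypothesis.Theorems.FeketeSOSAssemblyMagnification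

/-- **Odd Bertrand primes below `(n+1)^n`.** For every `n` there is an odd prime `p` with
`(n+1)^n < 2p` and `p ≤ (n+1)^n` whenever `n ≥ 2` (Bertrand's postulate applied to
`⌊(n+1)^n / 2⌋ ≥ 4`; for `n < 2` take `p = 3`). -/
theorem exists_odd_prime_window (n : ℕ) :
    ∃ p : ℕ, p.Prime ∧ p ≠ 2 ∧ (2 ≤ n → p ≤ (n + 1) ^ n) ∧ (2 ≤ n → (n + 1) ^ n < 2 * p) := by
  by_cases hn : 2 ≤ n
  · have h9 : 9 ≤ (n + 1) ^ n :=
      calc 9 = 3 ^ 2 := by norm_num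
        _ ≤ (n + 1) ^ 2 := Nat.pow_le_pow_left (by omega) 2
        _ ≤ (n + 1) ^ n := Nat.pow_le_pow_right (by omega) hn
    generalize hX : (n + 1) ^ n = X at h9 ⊢
    obtain ⟨p, hp, hlt, hle⟩ := Nat.exists_prime_lt_and_le_two_mul (X / 2) (by omega)
    exact ⟨p, hp, by omega, fun _ => by omega, fun _ => by omega⟩
  · exact ⟨3, Nat.prime_three, by norm_num, fun h => absurd h hn, fun h => absurd h hn⟩

/-- **Dutta–Saxena–Thierauf magnification for the Fekete family** (the bridge crux
`SOSMagnification`, item stmt-ValiantsHypothesis-3995, by name): if for some `δ > 0` and all large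
primes `p` every representation `F_p = Σ_{i<s} c_i g_i²` over `ℂ` with `s ≤ p^δ` squares of degree
`≤ p²` has support sum `Σ_i |supp g_i| ≥ p^{1/2+δ}`, then `VP_ℂ ≠ VNP_ℂ`.  Composition of the seven
landed stubs of line `sml-polarised-transport` (see the module docstring). -/
theorem sosMagnification :
    Summit.ValiantsHypothesis.ValiantsHypothesis.Theses.FeketeSOS.SOSMagnification := by
  classical
  unfold Summit.ValiantsHypothesis.ValiantsHypothesis.Theses.FeketeSOS.SOSMagnification
  intro hHard
  show Literature.Computability.AlgebraicComplexity.VP ℂ ≠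
    Literature.Computability.AlgebraicComplexity.VNP ℂ
  intro hEq
  obtain ⟨hKron, hFam⟩ := stub_digitKronecker
  -- (1) an odd prime selector with `(n+1)^n / 2 < p_n ≤ (n+1)^n` for `n ≥ 2`
  choose pSel hpP hp2 hple hpbig using exists_odd_prime_window
  haveI hFact : ∀ n, Fact (pSel n).Prime := fun n => ⟨hpP n⟩
  -- (2) the digit-lift family is in VNP (stubs C1, C2, C4), hence in VP under `VP = VNP`
  have h1 : @IsVNPFamily ℂ _ (fun n => Fin n × Fin (n + 1)) _
      (fun n => ∑ m ∈ Finset.range (pSel n), C ((legendreSym (pSel n) m : ℤ) : ℂ) *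
        ∏ j : Fin n, X (j, (⟨m / (n + 1) ^ (j : ℕ) % (n + 1),
          Nat.mod_lt _ (Nat.pos_of_neZero (n + 1))⟩ : Fin (n + 1)))) :=
    stub_vnpAssembly stub_legendreCircuit stub_oneHotLtCircuit pSel hp2 hple
  have hVP : @IsVPFamily ℂ _ (fun n => Fin n × Fin (n + 1)) _
      (fun n => ∑ m ∈ Finset.range (pSel n), C ((legendreSym (pSel n) m : ℤ) : ℂ) *
        ∏ j : Fin n, X (j, (⟨m / (n + 1) ^ (j : ℕ) % (n + 1),
          Nat.mod_lt _ (Nat.pos_of_neZero (n + 1))⟩ : Fin (n + 1)))) := by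
    have hmem := (mem_VNP_ofFintype_iff_holds (k := ℂ) (σ := fun n => Fin n × Fin (n + 1)) _).2 h1
    rw [← hEq] at hmem
    exact (mem_VP_ofFintype_iff_holds (k := ℂ) (σ := fun n => Fin n × Fin (n + 1)) _).1 hmem
  obtain ⟨c, hc⟩ := hVP.2
  -- (3) hardness data `(δ, p₀)`, the budget (stub T4) and a large level `n`
  obtain ⟨δ, hδ, p₀, H⟩ := hHard
  obtain ⟨n₀, hn₀⟩ := stub_budget c δ hδ
  obtain ⟨n, hn₀n, hp₀n, h2n⟩ : ∃ n, n₀ ≤ n ∧ p₀ ≤ n ∧ 2 ≤ n :=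
    ⟨max (max n₀ p₀) 2, le_trans (le_max_left _ _) (le_max_left _ _),
      le_trans (le_max_right _ _) (le_max_left _ _), le_max_right _ _⟩
  have hpk : pSel n ≤ (n + 1) ^ n := hple n h2n
  have hkp : (n + 1) ^ n < 2 * pSel n := hpbig n h2n
  -- the level-`n` member `P`, the inverse Kronecker substitution `κ`, the Fekete polynomial `F`
  set P : MvPolynomial (Fin n × Fin (n + 1)) ℂ :=
    ∑ m ∈ Finset.range (pSel n), C ((legendreSym (pSel n) m : ℤ) : ℂ) *
      ∏ j : Fin n, X (j, (⟨m / (n + 1) ^ (j : ℕ) % (n + 1),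
        Nat.mod_lt _ (Nat.pos_of_neZero (n + 1))⟩ : Fin (n + 1))) with hPdef
  set κ : Fin n × Fin (n + 1) → Polynomial ℂ :=
    fun v => (Polynomial.X : Polynomial ℂ) ^ ((v.2 : ℕ) * (n + 1) ^ (v.1 : ℕ)) with hκdef
  set F : Polynomial ℂ :=
    ∑ m ∈ Finset.range (pSel n), Polynomial.C ((legendreSym (pSel n) m : ℤ) : ℂ) * Polynomial.X ^ m
    with hFdef
  have hcn : complexity P ≤ n ^ c + c := hc n
  obtain ⟨hnp, hdegcap, hA, hB⟩ := hn₀ n hn₀n (complexity P) hcn (pSel n) hkp hpk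
  -- (4) digit-lift facts (stub T2 (b)): set-multilinear, total degree `n`, `κ P = F`
  obtain ⟨hsml, hdeg, hfaith⟩ :
      IsSetMultilinear (Prod.fst : Fin n × Fin (n + 1) → Fin n) Finset.univ P ∧
        P.totalDegree = n ∧ MvPolynomial.aeval κ P = F :=
    hFam (n + 1) (pSel n) n hpk
  -- (5) the bilinear middle cut at `j = n / 2` (tree: DST24 Lemma 3.1, steps 1–4)
  have h2deg : 2 ≤ P.totalDegree := by rw [hdeg]; exact h2n
  obtain ⟨-, Lst, hLlen, hLdeg, hLsum⟩ := exists_bilin_of_two_le_totalDegree P h2deg (n / 2)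
  rw [hdeg] at hLlen hLdeg
  set t := Lst.length with ht
  have hPsum : P = ∑ i : Fin t, (Lst[(i : ℕ)]).1 * (Lst[(i : ℕ)]).2 := by
    rw [Fin.sum_univ_fun_getElem Lst fun gh => gh.1 * gh.2]
    exact hLsum.symm
  have hgdeg : ∀ i : Fin t, (Lst[(i : ℕ)]).1.totalDegree ≤ n / 2 := fun i =>
    (hLdeg _ (List.getElem_mem i.2)).1
  have hhdeg : ∀ i : Fin t, (Lst[(i : ℕ)]).2.totalDegree ≤ n - n / 2 := fun i =>
    (hLdeg _ (List.getElem_mem i.2)).2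
  -- (6) set-multilinear projection + polarisation (stub T3, the lever)
  obtain ⟨s, a, q, hs, hrep, hsupp, hbsm⟩ :=
    stub_polarisedSOS n (n + 1) t (n / 2) (n - n / 2) P
      (fun i => (Lst[(i : ℕ)]).1) (fun i => (Lst[(i : ℕ)]).2) (by omega) hsml hPsum hgdeg hhdeg
  -- (7) Kronecker transport (stub T2 (a)) of the identity, the supports and the degrees
  have hGrep : (∑ i, Polynomial.C (a i) * (MvPolynomial.aeval κ (q i)) ^ 2) = F := by
    have h := congrArg (MvPolynomial.aeval κ) hrep
    rw [hfaith, map_sum] at h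
    simp only [map_mul, map_pow, MvPolynomial.aeval_C, Polynomial.algebraMap_eq] at h
    exact h.symm
  have hGsupp : ∀ i, (MvPolynomial.aeval κ (q i)).support.card ≤
      (n + 1) ^ (n / 2) + (n + 1) ^ (n - n / 2) := fun i =>
    ((hKron n (n + 1) (q i) (hbsm i)).1).trans (hsupp i)
  have hGdeg : ∀ i, (MvPolynomial.aeval κ (q i)).natDegree ≤ pSel n ^ 2 := fun i =>
    ((hKron n (n + 1) (q i) (hbsm i)).2).trans hdegcap
  -- (8) few squares: `s ≤ 2^{n+1} T ≤ p^δ`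
  have hsT : s ≤ 2 ^ (n + 1) * ((n + 1) * ((4 * complexity P * (n + 1) ^ 2) *
      (4 * complexity P * (n + 1) ^ 2)) ^ Nat.log 2 n) :=
    hs.trans (Nat.mul_le_mul_left _ hLlen)
  have hsR : (s : ℝ) ≤ (pSel n : ℝ) ^ δ := le_trans (by exact_mod_cast hsT) hA
  -- (9) the hardness hypothesis at the prime `p_n ≥ p₀` applied to the admitted representation
  have key := H (pSel n) (hp₀n.trans hnp) s a (fun i => MvPolynomial.aeval κ (q i)) hsR hGdeg hGrep
  -- (10) the support-sum count against the budget (b)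
  have hsum : (∑ i, ((MvPolynomial.aeval κ (q i)).support.card : ℝ)) ≤
      ((2 ^ (n + 1) * ((n + 1) * ((4 * complexity P * (n + 1) ^ 2) *
        (4 * complexity P * (n + 1) ^ 2)) ^ Nat.log 2 n) *
        ((n + 1) ^ (n / 2) + (n + 1) ^ (n - n / 2)) : ℕ) : ℝ) := by
    calc (∑ i, ((MvPolynomial.aeval κ (q i)).support.card : ℝ))
        ≤ ∑ _i : Fin s, (((n + 1) ^ (n / 2) + (n + 1) ^ (n - n / 2) : ℕ) : ℝ) :=
          Finset.sum_le_sum fun i _ => by exact_mod_cast hGsupp i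
      _ = (s : ℝ) * (((n + 1) ^ (n / 2) + (n + 1) ^ (n - n / 2) : ℕ) : ℝ) := by
          rw [Finset.sum_const, Finset.card_univ, Fintype.card_fin, nsmul_eq_mul]
      _ ≤ _ := by exact_mod_cast Nat.mul_le_mul_right _ hsT
  exact absurd (lt_of_le_of_lt (key.trans hsum) hB) (lt_irrefl _)

/-- **Assembly** (item stmt-ValiantsHypothesis-14917 of route `FeketeSOS`, rev 4):
`FeketeSOSHard → ValiantsHypothesis` — SOS-hardness of the Fekete polynomials against few sparse
squares of degree `≤ p²` implies `VP_ℂ ≠ VNP_ℂ`.  This is `sosMagnification` restated over the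
route declaration `FeketeSOSHard` (the two statements are definitionally equal). -/
theorem assembly_proof :
    Summit.ValiantsHypothesis.ValiantsHypothesis.Theses.FeketeSOS.Assembly := by
  unfold Summit.ValiantsHypothesis.ValiantsHypothesis.Theses.FeketeSOS.Assembly
  intros
  apply sosMagnification
  assumption

end Summit.ValiantsHypothesis.ValiantsHypothesis.Theorems.FeketeSOSAssemblyMagnification

end
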